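import Summits.CriticalPhenomena.PercolationContinuityZ3.Theorems.PercNearOneGluingNoHeavyLowerTailCILCutObserverTools
import HarnessLib

/-!
# `NoHeavyLowerTail` (stmt-CriticalPhenomena-4575) — tools for the cut-observer CIL with a glued root blob and
# multi-edge glued ports

Support file (prover `prim-gen-induct`; `--supports stmt-CriticalPhenomena-4575`).  No definitions, no named facts,
no sorries.  Companion of `…CILCutObserverTools` / `…CILCutObserver`: there the observer `o` is a bare cut vertex
attached to each branch by ONE edge to ONE port relay.  Here the root is a weight-1 clique `R ∋ o` (observer glued to
Steiner vertices), each branch `V l` carries a weight-1 port clique `P l ⊆ V l ∩ A`, and `R` is attached to `P l`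
by an arbitrary bundle of edges `F l = {s(r,v) : r ∈ R, v ∈ P l}` with arbitrary weights — i.e. every BLOB TREE whose
root blob is relay-free, with its first layer of blobs as ports and anything below.  This file holds the bookkeeping:

* the full-measure event `{nonzero-weight edges only} ∩ {all weight-1 edges open}` (`measureReal_inter_support₁`),
  weight-1 cliques are connected on it (`clique_reachable`), a walk leaving a vertex set crosses a boundary edge
  (`exists_boundary_edge`);
* `DeterminedBy` facts for bundle events `{some e ∈ F open}`, `{all e ∈ F closed}`, `{bundle open → branch light}` and
  the factorisation `measureReal_noHeavy_bundle : μ{X → M ≤ j} = μ(Xᶜ) + (1 − μ Xᶜ)·μ{M ≤ j}`;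
* membership / disjointness of the bundles `F l` and of the supports `F l ∪ (V l).sym2`.
-/

noncomputable section

namespace Summit.CriticalPhenomena.PercolationContinuityZ3.Theorems

open MeasureTheory Set Literature.Probability.LatticeModels Literature.Probability.Percolation
open scoped Classical BigOperators

variable {n : ℕ}

namespace CutObserver

/-! ### Full-measure event with the weight-1 edges open -/

/-- Intersecting with "nonzero-weight edges only, and every weight-1 edge open" does not change probabilities.
[folklore] -/
theorem measureReal_inter_support₁ (w : Sym2 (Fin n) → unitInterval) (E : Set (BondConfig (Fin n))) :
    (prodBernoulli w).real (E ∩ {ω | (∀ e ∈ ω, w e ≠ 0) ∧ ∀ e, w e = 1 → e ∈ ω}) =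
      (prodBernoulli w).real E := by
  haveI : IsProbabilityMeasure (prodBernoulli w) := inferInstance
  have hset : E ∩ {ω : BondConfig (Fin n) | (∀ e ∈ ω, w e ≠ 0) ∧ ∀ e, w e = 1 → e ∈ ω} =
      (E ∩ {ω : BondConfig (Fin n) | ∀ e, w e = 1 → e ∈ ω}) ∩ {ω | ∀ e ∈ ω, w e ≠ 0} := by
    ext ω; simp only [mem_inter_iff, mem_setOf_eq]; tauto
  rw [hset, measureReal_inter_support]
  -- the weight-1 edges are open a.s.
  have hnull : (prodBernoulli w).real {ω : BondConfig (Fin n) | ∀ e, w e = 1 → e ∈ ω}ᶜ = 0 := by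
    have hsub : {ω : BondConfig (Fin n) | ∀ e, w e = 1 → e ∈ ω}ᶜ ⊆
        ⋃ e ∈ (Finset.univ.filter fun e : Sym2 (Fin n) => w e = 1), {ω : BondConfig (Fin n) | e ∉ ω} := by
      intro ω hω
      simp only [mem_compl_iff, mem_setOf_eq, not_forall, exists_prop] at hω
      obtain ⟨e, he, hwe⟩ := hω
      exact mem_biUnion (Finset.mem_filter.2 ⟨Finset.mem_univ _, he⟩) hwe
    refine le_antisymm (le_trans (measureReal_mono hsub (measure_ne_top _ _)) ?_) measureReal_nonneg
    refine le_trans (measureReal_biUnion_finset_le _ _) (le_of_eq ?_)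
    refine Finset.sum_eq_zero fun e he => ?_
    rw [measureReal_closed, (Finset.mem_filter.1 he).2]
    norm_num
  have hsplit := measureReal_inter_add_sdiff₀ (μ := prodBernoulli w) (s := E)
    (MeasurableSet.of_discrete (s := {ω : BondConfig (Fin n) | ∀ e, w e = 1 → e ∈ ω})).nullMeasurableSet
  have hdiff : (prodBernoulli w).real (E \ {ω : BondConfig (Fin n) | ∀ e, w e = 1 → e ∈ ω}) = 0 :=
    le_antisymm (le_trans (measureReal_mono (fun ω hω => hω.2) (measure_ne_top _ _)) (le_of_eq hnull))
      measureReal_nonneg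
  linarith

/-- On the event "all weight-1 edges open", two vertices of a weight-1 clique are joined by an open path using
only edges inside any edge set containing the clique's pairs. [folklore] -/
theorem clique_reachable {ω : BondConfig (Fin n)} {w : Sym2 (Fin n) → unitInterval}
    (h1 : ∀ e, w e = 1 → e ∈ ω) (C : Finset (Fin n))
    (hC : ∀ u ∈ C, ∀ v ∈ C, u ≠ v → w s(u, v) = 1) (E : Set (Sym2 (Fin n)))
    (hE : ∀ u ∈ C, ∀ v ∈ C, s(u, v) ∈ E) {u v : Fin n} (hu : u ∈ C) (hv : v ∈ C) :
    (openGraph (ω ∩ E)).Reachable u v := by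
  by_cases huv : u = v
  · subst huv; exact SimpleGraph.Reachable.refl _
  · refine SimpleGraph.Adj.reachable ?_
    rw [openGraph, SimpleGraph.fromEdgeSet_adj]
    exact ⟨⟨h1 _ (hC u hu v hv huv), hE u hu v hv⟩, huv⟩

/-- An open path from inside a vertex set `R` to a vertex outside `R` uses an open boundary edge `s(r, v)`,
`r ∈ R`, `v ∉ R`. [folklore] -/
theorem exists_boundary_edge {V : Type*} (ω : BondConfig V) (R : Set V) {x y : V} (hx : x ∈ R) (hy : y ∉ R)
    (h : (openGraph ω).Reachable x y) : ∃ r ∈ R, ∃ v ∉ R, s(r, v) ∈ ω ∧ r ≠ v := by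
  obtain ⟨p⟩ := h
  induction p with
  | nil => exact absurd hx hy
  | @cons u v w' hadj p ih =>
    by_cases hvR : v ∈ R
    · exact ih hvR hy
    · rw [openGraph, SimpleGraph.fromEdgeSet_adj] at hadj
      exact ⟨u, hx, v, hvR, hadj.1, hadj.2⟩

/-! ### Bundle events -/

/-- `{some edge of F open}` is determined by `F`. [folklore] -/
theorem determinedBy_bundleOpen (F : Finset (Sym2 (Fin n))) :
    DeterminedBy {ω : BondConfig (Fin n) | ∃ e ∈ F, e ∈ ω} (↑F : Set (Sym2 (Fin n))) := by
  rw [determinedBy_iff]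
  intro ω ω' h
  simp only [mem_setOf_eq]
  constructor
  · rintro ⟨e, heF, he⟩
    exact ⟨e, heF, ((Set.ext_iff.1 h e).1 ⟨he, heF⟩).1⟩
  · rintro ⟨e, heF, he⟩
    exact ⟨e, heF, ((Set.ext_iff.1 h e).2 ⟨he, heF⟩).1⟩

/-- `{every edge of F closed}` is determined by `F`. [folklore] -/
theorem determinedBy_bundleClosed (F : Finset (Sym2 (Fin n))) :
    DeterminedBy {ω : BondConfig (Fin n) | ∀ e ∈ F, e ∉ ω} (↑F : Set (Sym2 (Fin n))) := by
  rw [determinedBy_iff]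
  intro ω ω' h
  simp only [mem_setOf_eq]
  constructor
  · intro hall e heF he
    exact hall e heF ((Set.ext_iff.1 h e).2 ⟨he, heF⟩).1
  · intro hall e heF he
    exact hall e heF ((Set.ext_iff.1 h e).1 ⟨he, heF⟩).1

/-- `{bundle open → branch light}` is determined by `F ∪ U.sym2`. [folklore] -/
theorem determinedBy_noHeavy_bundle (A U : Finset (Fin n)) (q : Fin n) (j : ℕ) (F : Finset (Sym2 (Fin n))) :
    DeterminedBy {ω : BondConfig (Fin n) | (∃ e ∈ F, e ∈ ω) →
        (A.filter fun x => (openGraph (ω ∩ ↑(U.sym2))).Reachable q x).card ≤ j}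
      (↑(F ∪ U.sym2) : Set (Sym2 (Fin n))) := by
  rw [determinedBy_iff]
  intro ω ω' h
  have hF : (∃ e ∈ F, e ∈ ω) ↔ ∃ e ∈ F, e ∈ ω' := by
    constructor
    · rintro ⟨e, heF, he⟩
      refine ⟨e, heF, ((Set.ext_iff.1 h e).1 ⟨he, ?_⟩).1⟩
      rw [Finset.coe_union]; exact Or.inl heF
    · rintro ⟨e, heF, he⟩
      refine ⟨e, heF, ((Set.ext_iff.1 h e).2 ⟨he, ?_⟩).1⟩
      rw [Finset.coe_union]; exact Or.inl heF
  have hU : ω ∩ ↑(U.sym2) = ω' ∩ ↑(U.sym2) := by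
    ext f
    have := Set.ext_iff.1 h f
    simp only [Finset.coe_union, mem_inter_iff, mem_union, Finset.mem_coe] at this ⊢
    constructor
    · rintro ⟨hf, hfU⟩; exact ⟨(this.1 ⟨hf, Or.inr hfU⟩).1, hfU⟩
    · rintro ⟨hf, hfU⟩; exact ⟨(this.2 ⟨hf, Or.inr hfU⟩).1, hfU⟩
  simp only [mem_setOf_eq]
  rw [hF, hU]

/-- `μ{bundle open → M ≤ j} = μ{bundle closed} + (1 − μ{bundle closed})·μ{M ≤ j}` when the bundle avoids the
branch edges. [folklore] -/
theorem measureReal_noHeavy_bundle (w : Sym2 (Fin n) → unitInterval) (A U : Finset (Fin n)) (q : Fin n)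
    (j : ℕ) (F : Finset (Sym2 (Fin n))) (hF : Disjoint F U.sym2) :
    (prodBernoulli w).real {ω : BondConfig (Fin n) | (∃ e ∈ F, e ∈ ω) →
        (A.filter fun x => (openGraph (ω ∩ ↑(U.sym2))).Reachable q x).card ≤ j} =
      (prodBernoulli w).real {ω : BondConfig (Fin n) | ∀ e ∈ F, e ∉ ω} +
        (1 - (prodBernoulli w).real {ω : BondConfig (Fin n) | ∀ e ∈ F, e ∉ ω}) *
          (prodBernoulli w).real {ω : BondConfig (Fin n) |
            (A.filter fun x => (openGraph (ω ∩ ↑(U.sym2))).Reachable q x).card ≤ j} := by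
  haveI : IsProbabilityMeasure (prodBernoulli w) := inferInstance
  set Sm := {ω : BondConfig (Fin n) |
    (A.filter fun x => (openGraph (ω ∩ ↑(U.sym2))).Reachable q x).card ≤ j} with hSm
  set X := {ω : BondConfig (Fin n) | ∃ e ∈ F, e ∈ ω} with hX
  set Xc := {ω : BondConfig (Fin n) | ∀ e ∈ F, e ∉ ω} with hXc
  have hXc_eq : Xc = Xᶜ := by
    ext ω; simp only [hXc, hX, mem_setOf_eq, mem_compl_iff, not_exists, not_and]
  have hsplit : {ω : BondConfig (Fin n) | ω ∈ X → ω ∈ Sm} = Xc ∪ (X ∩ Sm) := by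
    ext ω
    simp only [mem_setOf_eq, mem_union, mem_inter_iff, hXc_eq, mem_compl_iff]
    tauto
  have hdisj : Disjoint Xc (X ∩ Sm) := by
    rw [hXc_eq, Set.disjoint_left]
    rintro ω hω ⟨hω', _⟩
    exact hω hω'
  have hind : (prodBernoulli w).real (X ∩ Sm) = (prodBernoulli w).real X * (prodBernoulli w).real Sm :=
    prodBernoulli_real_inter_of_determinedBy_disjoint w hF (determinedBy_bundleOpen F)
      (by rw [hSm]; exact determinedBy_branchMass A U q j)
      MeasurableSet.of_discrete MeasurableSet.of_discrete
  have hXval : (prodBernoulli w).real X = 1 - (prodBernoulli w).real Xc := by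
    rw [hXc_eq, probReal_compl_eq_one_sub MeasurableSet.of_discrete]; ring
  change (prodBernoulli w).real {ω : BondConfig (Fin n) | ω ∈ X → ω ∈ Sm} = _
  rw [hsplit, measureReal_union hdisj MeasurableSet.of_discrete, hind, hXval]

/-! ### The bundles between the root blob and the port cliques -/

section Bundles

variable (R : Finset (Fin n)) {d : ℕ} (V P : Fin d → Finset (Fin n))

/-- Membership in the bundle `F l = {s(r,v) : r ∈ R, v ∈ P l}`. [folklore] -/
theorem mem_bundle_iff (l : Fin d) (e : Sym2 (Fin n)) :
    e ∈ (R ×ˢ P l).image (fun rv : Fin n × Fin n => s(rv.1, rv.2)) ↔ ∃ r ∈ R, ∃ v ∈ P l, e = s(r, v) := by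
  simp only [Finset.mem_image, Finset.mem_product, Prod.exists]
  constructor
  · rintro ⟨r, v, ⟨hr, hv⟩, rfl⟩; exact ⟨r, hr, v, hv, rfl⟩
  · rintro ⟨r, hr, v, hv, rfl⟩; exact ⟨r, v, ⟨hr, hv⟩, rfl⟩

/-- A bundle edge is not an edge inside a branch (the root blob is disjoint from the branches). [folklore] -/
theorem bundle_disjoint_sym2 (hRV : ∀ l, Disjoint R (V l)) (l l' : Fin d) :
    Disjoint ((R ×ˢ P l).image (fun rv : Fin n × Fin n => s(rv.1, rv.2))) (V l').sym2 := by
  rw [Finset.disjoint_left]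
  intro e he he'
  obtain ⟨r, hr, v, _, rfl⟩ := (mem_bundle_iff R P l e).1 he
  rw [Finset.mem_sym2_iff] at he'
  exact Finset.disjoint_left.1 (hRV l') hr (he' r (Sym2.mem_mk_left _ _))

/-- Bundles of different branches are disjoint. [folklore] -/
theorem bundle_disjoint_bundle (hPV : ∀ l, P l ⊆ V l) (hRV : ∀ l, Disjoint R (V l))
    (hdisj : ∀ l l', l ≠ l' → Disjoint (V l) (V l')) {l l' : Fin d} (hll' : l ≠ l') :
    Disjoint ((R ×ˢ P l).image (fun rv : Fin n × Fin n => s(rv.1, rv.2)))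
      ((R ×ˢ P l').image (fun rv : Fin n × Fin n => s(rv.1, rv.2))) := by
  rw [Finset.disjoint_left]
  intro e he he'
  obtain ⟨r, hr, v, hv, rfl⟩ := (mem_bundle_iff R P l e).1 he
  obtain ⟨r', hr', v', hv', heq⟩ := (mem_bundle_iff R P l' _).1 he'
  rcases Sym2.eq_iff.1 heq with ⟨_, hvv⟩ | ⟨hrv, _⟩
  · exact Finset.disjoint_left.1 (hdisj l l' hll') (hPV l hv) (hvv ▸ hPV l' hv')
  · exact Finset.disjoint_left.1 (hRV l') hr (hrv ▸ hPV l' hv')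

/-- The supports `F l ∪ (V l).sym2` of different branches are disjoint. [folklore] -/
theorem bundleSupports_disjoint (hPV : ∀ l, P l ⊆ V l) (hRV : ∀ l, Disjoint R (V l))
    (hdisj : ∀ l l', l ≠ l' → Disjoint (V l) (V l')) {l l' : Fin d} (hll' : l ≠ l') :
    Disjoint ((R ×ˢ P l).image (fun rv : Fin n × Fin n => s(rv.1, rv.2)) ∪ (V l).sym2)
      ((R ×ˢ P l').image (fun rv : Fin n × Fin n => s(rv.1, rv.2)) ∪ (V l').sym2) := by
  rw [Finset.disjoint_union_left, Finset.disjoint_union_right, Finset.disjoint_union_right]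
  refine ⟨⟨bundle_disjoint_bundle R V P hPV hRV hdisj hll', bundle_disjoint_sym2 R V P hRV l l'⟩,
    ⟨(bundle_disjoint_sym2 R V P hRV l' l).symm, ?_⟩⟩
  rw [Finset.disjoint_left]
  intro e he he'
  rw [Finset.mem_sym2_iff] at he he'
  have hx : e.out.1 ∈ e := Sym2.out_fst_mem e
  exact Finset.disjoint_left.1 (hdisj l l' hll') (he _ hx) (he' _ hx)

end Bundles

end CutObserver

end Summit.CriticalPhenomena.PercolationContinuityZ3.Theorems

end
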